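import Literature.NumberTheory.ComplexMultiplication.EllipticUnits.ImaginaryQuadraticMainConjectureCarriersLevels
import Literature.NumberTheory.GaloisRepresentations.LubinTateMultiplicativeGroup
import HarnessLib

/-!
# The group elements `σ = γ₁^{x₁}γ₂^{x₂} ↦ (1+T₁)^{x₁}(1+T₂)^{x₂} ∈ Λ₂` act on EVERY pinned carrier
# `H^i(𝒪_K[1/p𝔣], Λ(χ)(1))` (Johnson-Leung–Kings 2011 Def. 4.2 (94)) levelwise as conjugation by `σ`

Topic `Literature/NumberTheory/ComplexMultiplication/EllipticUnits` (grouping sub-namespace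
`JohnsonLeungKings2011`). Width seat `bsd-line-cf2-p1-w5` g9 (cell `bsd-print-cf2`), piece (G1) of the
cell's construction (M1)/F0b: the bridge between the (A1) Artin pin `artin_spec` of ty2 g37's
`TwistedIwasawaData` (`ImaginaryQuadraticMainConjectureCarriers.lean`) and the `Λ₂`-module structure
(P5)–(P8) of an ARBITRARY pinned datum `IwasawaCohomologyData`. Theorems only; no definition, no named
fact, no `instance`, no `sorry`.

THE STATEMENT (JLK §4.2 "the (left) `Λ_𝒪`-module structure" with §5.1 "`σ_𝔞 ∈ Gal(K_∞/K) ⊂ Λ`";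
Lang, *Cyclotomic Fields* Ch. 5 §1 "`γ ↦ 1 + T`"; Neukirch–Schmidt–Wingberg (5.3.5)): for every pinned
datum `I` (degree `i ≤ 2`), every `x ∈ H^i` and all `p`-adic exponents `x₁, x₂`, the level-`(n,k)`
component of `groupElt p x₁ x₂ • x = (1+T₁)^{x₁}(1+T₂)^{x₂} • x` is `conj_{γ₁}^{m₁} conj_{γ₂}^{m₂}` of the
component of `x`, `m_j = x_j mod pⁿ` (**`proj_groupElt_smul`**); hence it is `conj_g` of the component
for EVERY `g ∈ Γ_K` with `γ₁^{m₁}γ₂^{m₂}g⁻¹ ∈ Gal(K̄/K̃_n)` (**`proj_groupElt_smul_eq_layerConj`**) — the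
exact shape of the (A1) pin, so that for a `TwistedIwasawaData` the ring element `artin 𝔞` acts on the
level `(n,k)` of `H¹` as conjugation by Kato's lifted Artin symbol `(𝔞, K(p^s𝔣)/K)` for all large `s`
(**`TwistedIwasawaData.exists_proj_artin_smul`**), and `nsub 𝔞 = N𝔞 − χ(σ_𝔞)⁻¹σ_𝔞` acts as
`N𝔞 − χ(σ_𝔞)⁻¹·conj_{σ_𝔞}` (**`proj_nsubElt_smul`**) — the levelwise form in which the (Z2) pin
(Prop. 3.3 (3)) is verified on twisted Kummer classes.

THE PROOF: the binomial-series congruence `(1+T)^x ≡ (1+T)^m (mod (1+T)^{pⁿ} − 1)` in `ℤ_p⟦T⟧` for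
`x ≡ m (mod pⁿ)` (§1, from the tree's `LubinTate.binomialSeries_subst_one_add_X_pow_sub_one`
`(1 + ((1+T)^N − 1))^y = (1+T)^{Ny}`), transported into `Λ₂ = ℤ_p⟦T₂⟧⟦T₁⟧` along `map C` / `C`; on the
level, `(1+T_j)^m` acts as `conj_{γ_j}^m` by (P5)/(P6), `(1+T_j)^{pⁿ} − 1` acts as `conj_{γ_j}^{pⁿ} − 1 = 0`
(`γ_j^{pⁿ} ∈ Gal(K̄/K̃_n)` acts trivially in degrees `≤ 2`, part I `layerConjEnd_pow_apply_eq_self`), and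
multiples of it act as `0` by the continuity pin (P8).

## References
* [JohnsonLeungKings2011] J. Johnson-Leung, G. Kings, J. reine angew. Math. 653 (2011) = arXiv:0804.2828,
  §4.2 (the `Λ_𝒪`-module structure, p0012:L80–112), §5.1 (`σ_𝔞`, `N𝔞 − σ_𝔞`, p0014:L12–26).
* [Lang1990] S. Lang, *Cyclotomic Fields I and II*, GTM 121, Ch. 5 §1.
* [NeukirchSchmidtWingberg2008] J. Neukirch, A. Schmidt, K. Wingberg, *Cohomology of Number Fields*, (5.3.5).
* [deShalit1987] E. de Shalit, *Iwasawa theory of elliptic curves with complex multiplication*, I.3.2 (5).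
-/

noncomputable section

open scoped NumberField
open CategoryTheory Field IsDedekindDomain PowerSeries
open Literature.NumberTheory.GaloisRepresentations
open Literature.NumberTheory.EllipticCurves Literature.NumberTheory.EllipticCurves.IwasawaDual

namespace Literature.NumberTheory.ComplexMultiplication.EllipticUnits.JohnsonLeungKings2011

/-! ## §1 The binomial-series congruence `(1+T)^x ≡ (1+T)^{x mod pⁿ} (mod (1+T)^{pⁿ} − 1)` in `ℤ_p⟦T⟧` -/

section Binomial

variable {p : ℕ} [Fact p.Prime]

/-- **`(1+T)^{pⁿ·y} ≡ 1 (mod (1+T)^{pⁿ} − 1)`** in `ℤ_p⟦T⟧` for every `p`-adic exponent `y`: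
`(1+T)^{pⁿy} = G((1+T)^{pⁿ} − 1)` with `G = (1+T)^y = 1 + T·H`. [cite: deShalit1987, I.3.2 (5) (p. 17)] [cite: Lang1990, Ch. 5 §1] -/
theorem exists_binomialSeries_natCast_pow_mul_sub_one_eq (n : ℕ) (y : ℤ_[p]) :
    ∃ q : PowerSeries ℤ_[p], binomialSeries ℤ_[p] (((p ^ n : ℕ) : ℤ_[p]) * y) - 1 =
      ((1 + X : PowerSeries ℤ_[p]) ^ (p ^ n) - 1) * q := by
  set ω : PowerSeries ℤ_[p] := (1 + X) ^ (p ^ n) - 1 with hωdef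
  have hω : constantCoeff ω = 0 := LubinTate.constantCoeff_one_add_X_pow_sub_one (p ^ n)
  have hωs : HasSubst ω := HasSubst.of_constantCoeff_zero' hω
  set G : PowerSeries ℤ_[p] := binomialSeries ℤ_[p] y with hG
  obtain ⟨H, hH⟩ : ∃ H : PowerSeries ℤ_[p], G = 1 + X * H := by
    refine ⟨PowerSeries.mk fun j ↦ coeff (j + 1) G, ?_⟩
    ext j
    rcases j with _ | j
    · rw [coeff_zero_eq_constantCoeff, map_add, map_one, map_mul, constantCoeff_X, zero_mul, add_zero, hG,
        binomialSeries_constantCoeff]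
    · rw [map_add, coeff_one, if_neg (Nat.succ_ne_zero j), zero_add, coeff_succ_X_mul, coeff_mk]
  refine ⟨H.subst ω, ?_⟩
  rw [← LubinTate.binomialSeries_subst_one_add_X_pow_sub_one (p := p) (p ^ n) y, ← hωdef, ← hG, hH,
    subst_add hωs, subst_mul hωs, subst_X hωs, ← coe_substAlgHom hωs, map_one]
  ring

/-- **`(1+T)^x ≡ (1+T)^m (mod (1+T)^{pⁿ} − 1)`** in `ℤ_p⟦T⟧` whenever the `p`-adic exponent `x` is congruent
to the natural number `m` modulo `pⁿ`. [cite: Lang1990, Ch. 5 §1] [cite: NeukirchSchmidtWingberg2008, (5.3.5)] -/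
theorem exists_binomialSeries_sub_one_add_X_pow_eq {n : ℕ} {x : ℤ_[p]} {m : ℕ}
    (hx : PadicInt.toZModPow n x = (m : ZMod (p ^ n))) :
    ∃ q : PowerSeries ℤ_[p], binomialSeries ℤ_[p] x - (1 + X : PowerSeries ℤ_[p]) ^ m =
      ((1 + X : PowerSeries ℤ_[p]) ^ (p ^ n) - 1) * q := by
  have hker : x - (m : ℤ_[p]) ∈ RingHom.ker (PadicInt.toZModPow (p := p) n) := by
    rw [RingHom.mem_ker, map_sub, map_natCast, hx, sub_self]
  rw [PadicInt.ker_toZModPow, Ideal.mem_span_singleton] at hker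
  obtain ⟨y, hy⟩ := hker
  obtain ⟨q, hq⟩ := exists_binomialSeries_natCast_pow_mul_sub_one_eq n y
  refine ⟨(1 + X : PowerSeries ℤ_[p]) ^ m * q, ?_⟩
  have hx' : x = (m : ℤ_[p]) + ((p ^ n : ℕ) : ℤ_[p]) * y := by
    push_cast; linear_combination hy
  rw [hx', binomialSeries_add, binomialSeries_nat]
  linear_combination ((1 + X : PowerSeries ℤ_[p]) ^ m) * hq

/-- `(1+T)^x ≡ (1+T)^{(x mod pⁿ)} (mod (1+T)^{pⁿ} − 1)` with the canonical representative
`(toZModPow n x).val < pⁿ`. [cite: Lang1990, Ch. 5 §1] -/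
theorem exists_binomialSeries_sub_one_add_X_pow_val_eq (n : ℕ) (x : ℤ_[p]) :
    ∃ q : PowerSeries ℤ_[p], binomialSeries ℤ_[p] x - (1 + X : PowerSeries ℤ_[p]) ^ (PadicInt.toZModPow n x).val =
      ((1 + X : PowerSeries ℤ_[p]) ^ (p ^ n) - 1) * q :=
  exists_binomialSeries_sub_one_add_X_pow_eq (by rw [ZMod.natCast_zmod_val])

end Binomial

/-! ## §2 `(1+T₁)^{x₁}(1+T₂)^{x₂}` acts on the levels of every pinned datum as `conj_{γ₁}^{x₁ mod pⁿ} conj_{γ₂}^{x₂ mod pⁿ}` -/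

section Datum

variable {K : Type} [Field K] [NumberField K] {p : ℕ} [Fact p.Prime]
  {κ₁ κ₂ : ZpExtension K p} {γ₁ γ₂ : absoluteGaloisGroup K}
  {θ : absoluteGaloisGroup K →ₜ* ℤ_[p]ˣ} {𝔣 : Ideal (𝓞 K)} {i : ℕ}
  (I : IwasawaCohomologyData p κ₁ κ₂ γ₁ γ₂ θ 𝔣 i)

namespace IwasawaCohomologyData

/-- **`(1+T₁)^j` acts on the level `(n,k)` as `conj_{γ₁}^j`** ((P5) iterated). [cite: JohnsonLeungKings2011, §4.2 (arXiv p0012:L109–112)] -/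
theorem proj_one_add_X_pow_smul (j n k : ℕ) (x : I.H) :
    I.proj n k ((1 + PowerSeries.X : IwasawaAlgebra₂ p) ^ j • x) =
      (layerConjEnd p κ₁ κ₂ θ 𝔣 n k i γ₁ ^ j) (I.proj n k x) := by
  induction j generalizing x with
  | zero => rw [pow_zero, one_smul, pow_zero, AddMonoid.End.one_apply]
  | succ j ih =>
    rw [pow_succ, mul_smul, ih, pow_succ, AddMonoid.End.coe_mul, Function.comp_apply, add_smul, one_smul,
      map_add, I.proj_T₁_smul, add_sub_cancel]
    rfl

/-- **`(1+T₂)^j` acts on the level `(n,k)` as `conj_{γ₂}^j`** ((P6) iterated). [cite: JohnsonLeungKings2011, §4.2 (arXiv p0012:L109–112)] -/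
theorem proj_one_add_CX_pow_smul (j n k : ℕ) (x : I.H) :
    I.proj n k ((1 + PowerSeries.C (PowerSeries.X : IwasawaAlgebra p) : IwasawaAlgebra₂ p) ^ j • x) =
      (layerConjEnd p κ₁ κ₂ θ 𝔣 n k i γ₂ ^ j) (I.proj n k x) := by
  induction j generalizing x with
  | zero => rw [pow_zero, one_smul, pow_zero, AddMonoid.End.one_apply]
  | succ j ih =>
    rw [pow_succ, mul_smul, ih, pow_succ, AddMonoid.End.coe_mul, Function.comp_apply, add_smul, one_smul,
      map_add, I.proj_T₂_smul, add_sub_cancel]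
    rfl

/-- **`(1+T₁)^{pⁿ} − 1` kills the level `(n,k)`**, `i ≤ 2`: it acts as `conj_{γ₁}^{pⁿ} − 1 = conj_{γ₁^{pⁿ}} − 1` and
`γ₁^{pⁿ} ∈ Gal(K̄/K̃_n)`. [cite: Lang1990, Ch. 5 §1] [cite: JohnsonLeungKings2011, §4.2 (arXiv p0012:L109–112)] -/
theorem proj_map_omega_smul (hi : i ≤ 2) (n k : ℕ) (x : I.H) :
    I.proj n k ((PowerSeries.map PowerSeries.C (((1 + X : PowerSeries ℤ_[p]) ^ (p ^ n) - 1)) :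
      IwasawaAlgebra₂ p) • x) = 0 := by
  rw [map_sub, map_pow, map_add, map_one, PowerSeries.map_X, sub_smul, one_smul, map_sub,
    proj_one_add_X_pow_smul, layerConjEnd_pow_apply_eq_self p κ₁ κ₂ θ 𝔣 n k hi, sub_self]

/-- **`(1+T₂)^{pⁿ} − 1` kills the level `(n,k)`**, `i ≤ 2`. [cite: Lang1990, Ch. 5 §1] [cite: JohnsonLeungKings2011, §4.2 (arXiv p0012:L109–112)] -/
theorem proj_C_omega_smul (hi : i ≤ 2) (n k : ℕ) (x : I.H) :
    I.proj n k ((PowerSeries.C (((1 + X : PowerSeries ℤ_[p]) ^ (p ^ n) - 1)) : IwasawaAlgebra₂ p) • x) = 0 := by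
  rw [map_sub, map_pow, map_add, map_one, sub_smul, one_smul, map_sub,
    proj_one_add_CX_pow_smul, layerConjEnd_pow_apply_eq_self p κ₁ κ₂ θ 𝔣 n k hi, sub_self]

/-- **`(1+T₁)^{x₁}` acts on the level `(n,k)` as `conj_{γ₁}^{x₁ mod pⁿ}`**, `i ≤ 2`, for every `p`-adic exponent `x₁`.
[cite: JohnsonLeungKings2011, §4.2 (arXiv p0012:L109–112)] [cite: Lang1990, Ch. 5 §1] -/
theorem proj_map_binomialSeries_smul (hi : i ≤ 2) (x₁ : ℤ_[p]) (n k : ℕ) (x : I.H) :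
    I.proj n k ((PowerSeries.map PowerSeries.C (binomialSeries ℤ_[p] x₁) : IwasawaAlgebra₂ p) • x) =
      (layerConjEnd p κ₁ κ₂ θ 𝔣 n k i γ₁ ^ (PadicInt.toZModPow n x₁).val) (I.proj n k x) := by
  obtain ⟨q, hq⟩ := exists_binomialSeries_sub_one_add_X_pow_val_eq n x₁
  rw [sub_eq_iff_eq_add'] at hq
  rw [hq, map_add, map_pow, map_add, map_one, PowerSeries.map_X, add_smul, map_add, proj_one_add_X_pow_smul,
    map_mul, mul_comm, mul_smul, I.proj_smul_eq_zero n k _ _ (I.proj_map_omega_smul hi n k x), add_zero]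

/-- **`(1+T₂)^{x₂}` acts on the level `(n,k)` as `conj_{γ₂}^{x₂ mod pⁿ}`**, `i ≤ 2`. [cite: JohnsonLeungKings2011, §4.2 (arXiv p0012:L109–112)] [cite: Lang1990, Ch. 5 §1] -/
theorem proj_C_binomialSeries_smul (hi : i ≤ 2) (x₂ : ℤ_[p]) (n k : ℕ) (x : I.H) :
    I.proj n k ((PowerSeries.C (binomialSeries ℤ_[p] x₂) : IwasawaAlgebra₂ p) • x) =
      (layerConjEnd p κ₁ κ₂ θ 𝔣 n k i γ₂ ^ (PadicInt.toZModPow n x₂).val) (I.proj n k x) := by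
  obtain ⟨q, hq⟩ := exists_binomialSeries_sub_one_add_X_pow_val_eq n x₂
  rw [sub_eq_iff_eq_add'] at hq
  rw [hq, map_add, map_pow, map_add, map_one, add_smul, map_add, proj_one_add_CX_pow_smul,
    map_mul, mul_comm, mul_smul, I.proj_smul_eq_zero n k _ _ (I.proj_C_omega_smul hi n k x), add_zero]

/-- **`(1+T₁)^{x₁}(1+T₂)^{x₂}` acts on the level `(n,k)` of every pinned `H^i` (`i ≤ 2`) as
`conj_{γ₁}^{x₁ mod pⁿ} ∘ conj_{γ₂}^{x₂ mod pⁿ}`.** [cite: JohnsonLeungKings2011, §4.2 (arXiv p0012:L109–112), §5.1 (p0014:L12–20)] [cite: NeukirchSchmidtWingberg2008, (5.3.5)] -/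
theorem proj_groupElt_smul (hi : i ≤ 2) (x₁ x₂ : ℤ_[p]) (n k : ℕ) (x : I.H) :
    I.proj n k (groupElt p x₁ x₂ • x) =
      (layerConjEnd p κ₁ κ₂ θ 𝔣 n k i γ₁ ^ (PadicInt.toZModPow n x₁).val)
        ((layerConjEnd p κ₁ κ₂ θ 𝔣 n k i γ₂ ^ (PadicInt.toZModPow n x₂).val) (I.proj n k x)) := by
  rw [groupElt, mul_smul, I.proj_map_binomialSeries_smul hi, I.proj_C_binomialSeries_smul hi]

/-- **`(1+T₁)^{x₁}(1+T₂)^{x₂}` acts on the level `(n,k)` as conjugation by ANY `g ∈ Γ_K` with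
`γ₁^{x₁ mod pⁿ} γ₂^{x₂ mod pⁿ} g⁻¹ ∈ Gal(K̄/K̃_n)`** (`i ≤ 2`; the shape of the (A1) pin `artin_spec`).
[cite: JohnsonLeungKings2011, §5.1 (arXiv p0014:L12–20)] [cite: SerreLocalFields1979, VII §5 Prop. 3] -/
theorem proj_groupElt_smul_eq_layerConj (hi : i ≤ 2) {x₁ x₂ : ℤ_[p]} {n : ℕ} {g : absoluteGaloisGroup K}
    (hg : γ₁ ^ (PadicInt.toZModPow n x₁).val * γ₂ ^ (PadicInt.toZModPow n x₂).val * g⁻¹ ∈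
      pairLayerSubgroup κ₁ κ₂ n) (k : ℕ) (x : I.H) :
    I.proj n k (groupElt p x₁ x₂ • x) = layerConj p κ₁ κ₂ θ 𝔣 n k i g (I.proj n k x) := by
  rw [I.proj_groupElt_smul hi, layerConjEnd, layerConjEnd, conjEnd_pow_apply, conjEnd_pow_apply,
    levelConj_levelConj, ← inv_mul_cancel_right (γ₁ ^ _ * γ₂ ^ _) g, ← levelConj_levelConj,
    levelConj_eq_self_of_mem p (suppPF p 𝔣) θ hg (isOpen_pairLayerSubgroup κ₁ κ₂ n) k hi]
  rfl

/-- **`N𝔞 − χ(σ_𝔞)⁻¹(1+T₁)^{x₁}(1+T₂)^{x₂}` acts on the level `(n,k)` as `N𝔞 − (χ(σ_𝔞)⁻¹ mod p^k)·conj_g`** for any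
`g` as in `proj_groupElt_smul_eq_layerConj` (`i ≤ 2`) — the levelwise form of `nsubElt`, transcription
note (T3) of the carriers file. [cite: JohnsonLeungKings2011, §5.1 (arXiv p0014:L18–26), §3.3 (5) (p0010:L61–70)] -/
theorem proj_nsubElt_smul (hi : i ≤ 2) (a : AuxIdeals p 𝔣) {x₁ x₂ : ℤ_[p]} {n : ℕ} {g : absoluteGaloisGroup K}
    (hg : γ₁ ^ (PadicInt.toZModPow n x₁).val * γ₂ ^ (PadicInt.toZModPow n x₂).val * g⁻¹ ∈
      pairLayerSubgroup κ₁ κ₂ n) (k : ℕ) (x : I.H) :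
    I.proj n k (nsubElt p θ 𝔣 a x₁ x₂ • x) =
      ((Ideal.absNorm a.1 : ℕ) : ℤ) • I.proj n k x -
        ((PadicInt.toZModPow k (((thetaArtin p θ 𝔣 a)⁻¹ : ℤ_[p]ˣ) : ℤ_[p])).val : ℤ) •
          layerConj p κ₁ κ₂ θ 𝔣 n k i g (I.proj n k x) := by
  rw [nsubElt, sub_smul, map_sub, Nat.cast_smul_eq_nsmul, map_nsmul, ← natCast_zsmul, mul_smul,
    I.proj_C_smul, I.proj_groupElt_smul_eq_layerConj hi hg]

end IwasawaCohomologyData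

/-- **For a `TwistedIwasawaData`, `artin 𝔞 = (𝔞, K_∞/K) ∈ Λ₂` acts on the level `(n,k)` of `H¹` as conjugation by
Kato's lifted Artin symbol `(𝔞, K(p^s𝔣)/K) ∈ Γ_K` for every large `s` with `K̃_n ⊆ K(p^s𝔣)`** ((A1) + `proj_groupElt_smul_eq_layerConj`).
[cite: JohnsonLeungKings2011, §5.1 (arXiv p0014:L12–20)] [cite: Kato2004Asterisque, §15.1 (p. 250)] -/
theorem TwistedIwasawaData.exists_proj_artin_smul {ι : K →+* ℂ} (D : TwistedIwasawaData p κ₁ κ₂ γ₁ γ₂ θ 𝔣 ι)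
    (a : AuxIdeals p 𝔣) (n : ℕ) : ∃ s₀ : ℕ, ∀ s : ℕ, s₀ ≤ s →
      katoLevelSubgroup p 𝔣 s ≤ pairLayerSubgroup κ₁ κ₂ n → ∀ (k : ℕ) (x : D.D1.H),
        D.D1.proj n k (D.artin a • x) = layerConj p κ₁ κ₂ θ 𝔣 n k 1 (layerArtin p 𝔣 s a.1) (D.D1.proj n k x) := by
  obtain ⟨s₀, hs₀⟩ := D.artin_spec a n
  exact ⟨s₀, fun s hs hle k x ↦ D.D1.proj_groupElt_smul_eq_layerConj (by omega) (hs₀ s hs hle) k x⟩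

/-- **For a `TwistedIwasawaData`, `nsub 𝔞 = N𝔞 − χ(σ_𝔞)⁻¹σ_𝔞` acts on the level `(n,k)` of `H¹` as
`N𝔞 − (χ(σ_𝔞)⁻¹ mod p^k)·conj_{(𝔞, K(p^s𝔣)/K)}`** for every large `s` with `K̃_n ⊆ K(p^s𝔣)` — the levelwise
form in which the (Z2) pin is an identity of twisted Kummer classes. [cite: JohnsonLeungKings2011, §5.1 (arXiv p0014:L18–26), Prop. 3.3 (3) (p0009:L88–95)] -/
theorem TwistedIwasawaData.exists_proj_nsub_smul {ι : K →+* ℂ} (D : TwistedIwasawaData p κ₁ κ₂ γ₁ γ₂ θ 𝔣 ι)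
    (a : AuxIdeals p 𝔣) (n : ℕ) : ∃ s₀ : ℕ, ∀ s : ℕ, s₀ ≤ s →
      katoLevelSubgroup p 𝔣 s ≤ pairLayerSubgroup κ₁ κ₂ n → ∀ (k : ℕ) (x : D.D1.H),
        D.D1.proj n k (D.nsub a • x) =
          ((Ideal.absNorm a.1 : ℕ) : ℤ) • D.D1.proj n k x -
            ((PadicInt.toZModPow k (((thetaArtin p θ 𝔣 a)⁻¹ : ℤ_[p]ˣ) : ℤ_[p])).val : ℤ) •
              layerConj p κ₁ κ₂ θ 𝔣 n k 1 (layerArtin p 𝔣 s a.1) (D.D1.proj n k x) := by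
  obtain ⟨s₀, hs₀⟩ := D.artin_spec a n
  exact ⟨s₀, fun s hs hle k x ↦ D.D1.proj_nsubElt_smul (by omega) a (hs₀ s hs hle) k x⟩

end Datum

end Literature.NumberTheory.ComplexMultiplication.EllipticUnits.JohnsonLeungKings2011

end
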